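import Summits.NavierStokesRegularity.NavierStokesRegularity.Theorems.EfficiencyFloorRigidExitScaleClock
import Literature.Analysis.FluidPDE.VorticityCalculus
import Literature.Analysis.FluidPDE.RapidDecayLemmas
import HarnessLib

/-!
# Route `EfficiencyFloor`, support `RigidExit` (stmt-25513) on the `ProductionEfficiencyDecay` ladder (stmt-22866):
# ORBIT MEMBERSHIP IS CLOSED ALONG THE FLOW — topological orbit selection on a maximiser interval

Helper file (`--supports stmt-NavierStokesRegularity-22866`; line `efficiency_floor`), sequel to `…RigidExitScaleClock`. Item (i)
ORBIT SELECTION of the landed READING of `RigidExit` has a topological half — «under clause (a) (finitely many maximiser orbits) a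
maximiser INTERVAL of the flow contains a sub-interval inside ONE symmetry orbit» — and a differential half (differentiable rotation /
translation paths; the scale path is free by `…ScaleClock`). This file proves the topological half, for profiles vanishing at infinity
(true for every admissible profile, `H²(ℝ³) ⊂ C₀(ℝ³)`; kept as an explicit hypothesis `Tendsto m (cocompact) (𝓝 0)` here):

* `exists_subseq_isometry` (§1): sequential compactness of the linear isometries of `ℝ³` together with their inverses, in operator norm
  (Bolzano–Weierstrass in the finite-dimensional operator space; the limit is again an isometry, inverted by the limit of the inverses).
* `exists_subseq_norm_tendsto_atTop` (§1): an unbounded sequence of vectors has a subsequence with norms `→ ∞`.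
* `integral_curl_sq_pos`, `exists_ne_zero` (§2, BY NAME): along a solution of the route's class every slice `u t`, `t ∈ (0,T)`, has
  `∫|curl u(t)|² > 0`, hence is not identically zero.
* `mem_orbit_of_tendsto` (§3, BY NAME — CLOSEDNESS): along every maximal classical Leray–Hopf rapidly-decaying-datum solution, if
  `tₙ → t` in `(0,T)` and every slice `u tₙ` lies in the symmetry orbit `{l • R (m (l • R⁻¹(· − a)))}` of a continuous profile `m` with
  `Z(m) > 0` vanishing at infinity, then so does `u t`. Mechanism: the scales are `lₙ = Z(u tₙ)/Z(m) → Z(u t)/Z(m) > 0` (`…ScaleClock`,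
  continuity of the enstrophy); the isometries subconverge (§1); the translations are bounded — otherwise the slices would tend to `0` at
  a point where `u t ≠ 0` (profile vanishing at infinity, pointwise continuity of the trajectory) — and subconverge; pointwise limits
  identify `u t` with the limiting orbit point.
* `isClosed_orbitSet` (§3): so the orbit-membership instants of `[s,s₁] ⊂ (0,T)` form a CLOSED set.
* `exists_single_orbit_subinterval` (§4, BY NAME — TOPOLOGICAL ORBIT SELECTION): under the CLASSIFICATION half of clause (a) of
  `MaximiserSetRigidity` (finitely many representatives `ms i`, each vanishing at infinity), a maximiser interval `[s,s₁] ⊂ (0,T)`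
  contains a non-degenerate sub-interval `[s',s₁']` all of whose slices lie in the orbit of ONE representative `ms i` (Baire: finitely
  many closed sets covering `[s,s₁]`).

What remains of item (i) after this file and `…ScaleClock`: differentiable ROTATION and TRANSLATION paths on a single-orbit interval
(slice theorem for the Euclidean group acting on `H²` profiles), and the embedding `H²(ℝ³) ⊂ C₀` discharging the vanishing hypothesis.
HONEST FRAMING: statements about a HYPOTHETICAL blow-up; `RigidExit`, clause (a), `NearMaximiserBoundedAmplification`, `LerayFloorGap`,
`ProductionEfficiencyDecay` (stmt-22866) and Navier–Stokes regularity stay OPEN; no summit statement is proved. [folklore]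
-/

-- the problem directory repeats the summit name (`NavierStokesRegularity/NavierStokesRegularity`)
set_option linter.dupNamespace false

noncomputable section

open Set Filter MeasureTheory Topology Function Bornology
open scoped InnerProductSpace RealInnerProductSpace ENNReal NNReal
open Literature.Analysis.FluidPDE

namespace Summit.NavierStokesRegularity.NavierStokesRegularity.Theorems

namespace RigidExit

namespace OrbitClosed

open NearMaximiserBoundedAmplification MaximiserSetRigidity.ProfileLiouville Resonance ScaleClock

/-! ## §1 Compactness tools -/

/-- Evaluation `(F, v) ↦ F v` is jointly continuous: operator-norm convergence `Fₙ → F` and `vₙ → v` give `Fₙ vₙ → F v`. [folklore] -/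
theorem tendsto_clm_apply {ι : Type*} {l : Filter ι}
    {F : ι → (EuclideanSpace ℝ (Fin 3) →L[ℝ] EuclideanSpace ℝ (Fin 3))} {F₀ : EuclideanSpace ℝ (Fin 3) →L[ℝ] EuclideanSpace ℝ (Fin 3)}
    {v : ι → EuclideanSpace ℝ (Fin 3)} {v₀ : EuclideanSpace ℝ (Fin 3)}
    (hF : Tendsto F l (𝓝 F₀)) (hv : Tendsto v l (𝓝 v₀)) : Tendsto (fun i => F i (v i)) l (𝓝 (F₀ v₀)) := by
  have hc : Continuous fun p : (EuclideanSpace ℝ (Fin 3) →L[ℝ] EuclideanSpace ℝ (Fin 3)) × EuclideanSpace ℝ (Fin 3) => p.1 p.2 :=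
    isBoundedBilinearMap_apply.continuous
  exact (hc.tendsto (F₀, v₀)).comp (hF.prodMk_nhds hv)

/-- **Sequential compactness of the isometry group of `ℝ³` (with inverses).** Every sequence of linear isometries `Rₙ` of `ℝ³` has a
subsequence along which `Rₙ → L` and `Rₙ⁻¹ → L⁻¹` in operator norm, for some linear isometry `L`. [folklore] -/
theorem exists_subseq_isometry (R : ℕ → (EuclideanSpace ℝ (Fin 3) ≃ₗᵢ[ℝ] EuclideanSpace ℝ (Fin 3))) :
    ∃ (L : EuclideanSpace ℝ (Fin 3) ≃ₗᵢ[ℝ] EuclideanSpace ℝ (Fin 3)) (φ : ℕ → ℕ), StrictMono φ ∧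
      Tendsto (fun n => ((R (φ n)).toContinuousLinearEquiv : EuclideanSpace ℝ (Fin 3) →L[ℝ] EuclideanSpace ℝ (Fin 3))) atTop
        (𝓝 (L.toContinuousLinearEquiv : EuclideanSpace ℝ (Fin 3) →L[ℝ] EuclideanSpace ℝ (Fin 3))) ∧
      Tendsto (fun n => ((R (φ n)).symm.toContinuousLinearEquiv : EuclideanSpace ℝ (Fin 3) →L[ℝ] EuclideanSpace ℝ (Fin 3))) atTop
        (𝓝 (L.symm.toContinuousLinearEquiv : EuclideanSpace ℝ (Fin 3) →L[ℝ] EuclideanSpace ℝ (Fin 3))) := by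
  set P : ℕ → (EuclideanSpace ℝ (Fin 3) →L[ℝ] EuclideanSpace ℝ (Fin 3)) × (EuclideanSpace ℝ (Fin 3) →L[ℝ] EuclideanSpace ℝ (Fin 3)) :=
    fun n => (((R n).toContinuousLinearEquiv : EuclideanSpace ℝ (Fin 3) →L[ℝ] EuclideanSpace ℝ (Fin 3)),
      ((R n).symm.toContinuousLinearEquiv : EuclideanSpace ℝ (Fin 3) →L[ℝ] EuclideanSpace ℝ (Fin 3))) with hP
  -- the pairs live in a bounded set of the (proper) product space
  have hbd : IsBounded (Metric.closedBall (0 : (EuclideanSpace ℝ (Fin 3) →L[ℝ] EuclideanSpace ℝ (Fin 3)) ×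
      (EuclideanSpace ℝ (Fin 3) →L[ℝ] EuclideanSpace ℝ (Fin 3))) 1) := Metric.isBounded_closedBall
  have hmem : ∀ n, P n ∈ Metric.closedBall (0 : (EuclideanSpace ℝ (Fin 3) →L[ℝ] EuclideanSpace ℝ (Fin 3)) ×
      (EuclideanSpace ℝ (Fin 3) →L[ℝ] EuclideanSpace ℝ (Fin 3))) 1 := by
    intro n
    rw [Metric.mem_closedBall, dist_zero_right, Prod.norm_def, max_le_iff]
    exact ⟨(R n).toLinearIsometry.norm_toContinuousLinearMap_le, (R n).symm.toLinearIsometry.norm_toContinuousLinearMap_le⟩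
  obtain ⟨⟨L₁, L₂⟩, -, φ, hφ, hlim⟩ := tendsto_subseq_of_bounded hbd hmem
  have h1 : Tendsto (fun n => ((R (φ n)).toContinuousLinearEquiv : EuclideanSpace ℝ (Fin 3) →L[ℝ] EuclideanSpace ℝ (Fin 3)))
      atTop (𝓝 L₁) := (continuous_fst.tendsto _).comp hlim
  have h2 : Tendsto (fun n => ((R (φ n)).symm.toContinuousLinearEquiv : EuclideanSpace ℝ (Fin 3) →L[ℝ] EuclideanSpace ℝ (Fin 3)))
      atTop (𝓝 L₂) := (continuous_snd.tendsto _).comp hlim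
  -- `L₁` is norm preserving
  have hnorm : ∀ v, ‖L₁ v‖ = ‖v‖ := by
    intro v
    have hv : Tendsto (fun n => ((R (φ n)).toContinuousLinearEquiv : EuclideanSpace ℝ (Fin 3) →L[ℝ] EuclideanSpace ℝ (Fin 3)) v)
        atTop (𝓝 (L₁ v)) := tendsto_clm_apply h1 tendsto_const_nhds
    have hc : (fun n => ‖((R (φ n)).toContinuousLinearEquiv : EuclideanSpace ℝ (Fin 3) →L[ℝ] EuclideanSpace ℝ (Fin 3)) v‖) =
        fun _ => ‖v‖ := by
      funext n
      simp
    have := hv.norm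
    rw [hc] at this
    exact tendsto_nhds_unique this tendsto_const_nhds
  -- `L₂ ∘ L₁ = id`
  have hinv : ∀ v, L₂ (L₁ v) = v := by
    intro v
    have hv : Tendsto (fun n => ((R (φ n)).toContinuousLinearEquiv : EuclideanSpace ℝ (Fin 3) →L[ℝ] EuclideanSpace ℝ (Fin 3)) v)
        atTop (𝓝 (L₁ v)) := tendsto_clm_apply h1 tendsto_const_nhds
    have hw := tendsto_clm_apply h2 hv
    have hc : (fun n => ((R (φ n)).symm.toContinuousLinearEquiv : EuclideanSpace ℝ (Fin 3) →L[ℝ] EuclideanSpace ℝ (Fin 3))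
        (((R (φ n)).toContinuousLinearEquiv : EuclideanSpace ℝ (Fin 3) →L[ℝ] EuclideanSpace ℝ (Fin 3)) v)) = fun _ => v := by
      funext n
      simp
    rw [hc] at hw
    exact tendsto_nhds_unique hw tendsto_const_nhds
  -- assemble the isometry equivalence
  let Li : EuclideanSpace ℝ (Fin 3) →ₗᵢ[ℝ] EuclideanSpace ℝ (Fin 3) := ⟨L₁.toLinearMap, hnorm⟩
  let L : EuclideanSpace ℝ (Fin 3) ≃ₗᵢ[ℝ] EuclideanSpace ℝ (Fin 3) := Li.toLinearIsometryEquiv rfl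
  have hL : ∀ v, L v = L₁ v := fun v => by simp [L, Li]
  have hLsymm : ∀ w, L.symm w = L₂ w := by
    intro w
    have h := hinv (L.symm w)
    rw [← hL, L.apply_symm_apply] at h
    exact h.symm
  refine ⟨L, φ, hφ, ?_, ?_⟩
  · have hE : (L.toContinuousLinearEquiv : EuclideanSpace ℝ (Fin 3) →L[ℝ] EuclideanSpace ℝ (Fin 3)) = L₁ := by
      ext v i
      simp only [hL v, ContinuousLinearEquiv.coe_coe, LinearIsometryEquiv.coe_toContinuousLinearEquiv]
    rw [hE]; exact h1
  · have hE : (L.symm.toContinuousLinearEquiv : EuclideanSpace ℝ (Fin 3) →L[ℝ] EuclideanSpace ℝ (Fin 3)) = L₂ := by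
      ext v i
      simp only [hLsymm v, ContinuousLinearEquiv.coe_coe, LinearIsometryEquiv.coe_toContinuousLinearEquiv]
    rw [hE]; exact h2

/-- **An unbounded sequence of vectors has a subsequence with norms tending to infinity.** [folklore] -/
theorem exists_subseq_norm_tendsto_atTop {a : ℕ → EuclideanSpace ℝ (Fin 3)} (ha : ¬ ∃ r : ℝ, ∀ n, ‖a n‖ ≤ r) :
    ∃ ψ : ℕ → ℕ, StrictMono ψ ∧ Tendsto (fun k => ‖a (ψ k)‖) atTop atTop := by
  have hfreq : ∀ k : ℕ, ∃ᶠ n in atTop, (k : ℝ) < ‖a n‖ := by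
    intro k
    rw [frequently_atTop]
    intro N
    by_contra hcon
    push Not at hcon
    apply ha
    refine ⟨k + ∑ i ∈ Finset.range N, ‖a i‖, fun n => ?_⟩
    have hsum : 0 ≤ ∑ i ∈ Finset.range N, ‖a i‖ := Finset.sum_nonneg fun i _ => norm_nonneg _
    by_cases hn : N ≤ n
    · have := hcon n hn
      linarith
    · push Not at hn
      have hle : ‖a n‖ ≤ ∑ i ∈ Finset.range N, ‖a i‖ :=
        Finset.single_le_sum (f := fun i => ‖a i‖) (fun i _ => norm_nonneg _) (Finset.mem_range.2 hn)
      have hk : (0 : ℝ) ≤ k := Nat.cast_nonneg k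
      linarith
  obtain ⟨ψ, hψ, hP⟩ := extraction_forall_of_frequently hfreq
  refine ⟨ψ, hψ, ?_⟩
  refine tendsto_atTop_mono (fun k => (hP k).le) tendsto_natCast_atTop_atTop

/-! ## §2 BY NAME: slices of the route's class are never identically zero -/

/-- **Positive (Bochner) enstrophy at every interior time.** [cite: RobinsonRodrigoSadowski2016, Lemma 6.13] -/
theorem integral_curl_sq_pos {ν T : ℝ} (hν : 0 < ν) (hT : 0 < T)
    {u : ℝ → EuclideanSpace ℝ (Fin 3) → EuclideanSpace ℝ (Fin 3)} {p : ℝ → EuclideanSpace ℝ (Fin 3) → ℝ}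
    (hmax : IsMaximalSmoothSolution ν 0 u p T) (hLH : IsLerayHopfOn T ν 0 (u 0) u) (hdec : HasRapidSpatialDecay (u 0)) :
    ∀ t ∈ Ioo 0 T, 0 < ∫ x, ‖curl (u t) x‖ ^ 2 := by
  intro t ht
  obtain ⟨c, -, hbud⟩ := exists_budget_saturated_iff_normalisedMaximiser
  obtain ⟨Zr, D, hZD, -⟩ := hbud ν T hν hT u p hmax hLH hdec
  obtain ⟨hlin, -, -, hZeq, -⟩ := hZD t ht
  have h1 := lintegral_curl_sq_pos hν hT hmax hLH hdec t ⟨ht.1.le, ht.2⟩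
  rw [hlin] at h1
  rw [← hZeq]
  exact ENNReal.ofReal_pos.1 h1

/-- **No slice vanishes identically.** [folklore] -/
theorem exists_ne_zero {ν T : ℝ} (hν : 0 < ν) (hT : 0 < T)
    {u : ℝ → EuclideanSpace ℝ (Fin 3) → EuclideanSpace ℝ (Fin 3)} {p : ℝ → EuclideanSpace ℝ (Fin 3) → ℝ}
    (hmax : IsMaximalSmoothSolution ν 0 u p T) (hLH : IsLerayHopfOn T ν 0 (u 0) u) (hdec : HasRapidSpatialDecay (u 0)) :
    ∀ t ∈ Ioo 0 T, ∃ x, u t x ≠ 0 := by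
  intro t ht
  by_contra h
  push Not at h
  have hu : u t = fun _ => (0 : EuclideanSpace ℝ (Fin 3)) := funext h
  have hZ := integral_curl_sq_pos hν hT hmax hLH hdec t ht
  rw [hu] at hZ
  simp at hZ

/-! ## §3 BY NAME: orbit membership is closed along the flow -/

/-- **Closedness of orbit membership along the flow.** Along a maximal classical solution on `[0,T)` that is Leray–Hopf from a
rapidly decaying datum: if `tₙ → t` in `(0,T)` and every slice `u tₙ` has the orbit form `l • R (m (l • R⁻¹(· − a)))` (`l > 0`, `R` a
linear isometry) over a continuous profile `m` with `∫|curl m|² > 0` and `m → 0` at infinity, then `u t` has the same orbit form.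
[folklore] -/
theorem mem_orbit_of_tendsto {ν T : ℝ} (hν : 0 < ν) (hT : 0 < T)
    {u : ℝ → EuclideanSpace ℝ (Fin 3) → EuclideanSpace ℝ (Fin 3)} {p : ℝ → EuclideanSpace ℝ (Fin 3) → ℝ}
    (hmax : IsMaximalSmoothSolution ν 0 u p T) (hLH : IsLerayHopfOn T ν 0 (u 0) u) (hdec : HasRapidSpatialDecay (u 0))
    {m : EuclideanSpace ℝ (Fin 3) → EuclideanSpace ℝ (Fin 3)} (hmc : Continuous m)
    (hm0 : Tendsto m (cocompact (EuclideanSpace ℝ (Fin 3))) (𝓝 0)) (hZm : 0 < ∫ x, ‖curl m x‖ ^ 2)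
    {t : ℝ} (ht : t ∈ Ioo 0 T) {tn : ℕ → ℝ} (hlim : Tendsto tn atTop (𝓝 t))
    (hmem : ∀ n, ∃ (a : EuclideanSpace ℝ (Fin 3)) (R : EuclideanSpace ℝ (Fin 3) ≃ₗᵢ[ℝ] EuclideanSpace ℝ (Fin 3)) (l : ℝ),
      0 < l ∧ u (tn n) = fun x => l • R (m (l • R.symm (x - a)))) :
    ∃ (a : EuclideanSpace ℝ (Fin 3)) (R : EuclideanSpace ℝ (Fin 3) ≃ₗᵢ[ℝ] EuclideanSpace ℝ (Fin 3)) (l : ℝ),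
      0 < l ∧ u t = fun x => l • R (m (l • R.symm (x - a))) := by
  choose a R l hl hu using hmem
  set Z : ℝ → ℝ := fun τ => ∫ x, ‖curl (u τ) x‖ ^ 2 with hZdef
  -- scales are enstrophy ratios, hence converge to `Z t / Z(m) > 0`
  have hln : ∀ n, l n = Z (tn n) / ∫ x, ‖curl m x‖ ^ 2 := fun n => scale_eq_enstrophy_ratio' (hl n) hZm (hu n)
  have hZcont : ContinuousAt Z t := (hasDerivAt_enstrophy hν hT hmax hLH hdec t ht).continuousAt
  set l₀ : ℝ := Z t / ∫ x, ‖curl m x‖ ^ 2 with hl₀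
  have hl₀pos : 0 < l₀ := div_pos (integral_curl_sq_pos hν hT hmax hLH hdec t ht) hZm
  have hlconv : Tendsto l atTop (𝓝 l₀) := by
    have h1 : Tendsto (fun n => Z (tn n) / ∫ x, ‖curl m x‖ ^ 2) atTop (𝓝 l₀) :=
      ((hZcont.tendsto.comp hlim).div_const _)
    refine h1.congr fun n => (hln n).symm
  -- pointwise continuity of the trajectory
  have hsm : IsSmoothSpaceTimeOn (Ico 0 T) u := hmax.isClassicalNSSolutionOn.smooth_velocity
  have hptw : ∀ x, Tendsto (fun n => u (tn n) x) atTop (𝓝 (u t x)) := by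
    intro x
    have hc : ContinuousAt (fun s => u s x) t :=
      (hsm.continuousOn_time x).continuousAt (Ico_mem_nhds ht.1 ht.2)
    exact hc.tendsto.comp hlim
  -- isometries subconverge
  obtain ⟨L, φ, hφ, hR1, hR2⟩ := exists_subseq_isometry R
  have hφt : Tendsto (tn ∘ φ) atTop (𝓝 t) := hlim.comp hφ.tendsto_atTop
  by_cases hb : ∃ r : ℝ, ∀ n, ‖a (φ n)‖ ≤ r
  · -- bounded translations: subconverge, and pass to the limit pointwise
    obtain ⟨r, hr⟩ := hb
    obtain ⟨a₀, -, ψ, hψ, haconv⟩ := tendsto_subseq_of_bounded (Metric.isBounded_closedBall (x := (0 : EuclideanSpace ℝ (Fin 3)))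
      (r := r)) (fun n => by rw [Metric.mem_closedBall, dist_zero_right]; exact hr n)
    refine ⟨a₀, L, l₀, hl₀pos, funext fun x => ?_⟩
    have hχ : StrictMono (φ ∘ ψ) := hφ.comp hψ
    -- the orbit points converge to the limiting orbit point at `x`
    have hlχ : Tendsto (fun k => l (φ (ψ k))) atTop (𝓝 l₀) := hlconv.comp hχ.tendsto_atTop
    have haχ : Tendsto (fun k => a (φ (ψ k))) atTop (𝓝 a₀) := haconv
    have hR1χ := hR1.comp hψ.tendsto_atTop
    have hR2χ := hR2.comp hψ.tendsto_atTop
    have hinner : Tendsto (fun k => l (φ (ψ k)) • (R (φ (ψ k))).symm (x - a (φ (ψ k)))) atTop (𝓝 (l₀ • L.symm (x - a₀))) := by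
      have h1 : Tendsto (fun k => ((R (φ (ψ k))).symm.toContinuousLinearEquiv : EuclideanSpace ℝ (Fin 3) →L[ℝ] EuclideanSpace ℝ (Fin 3))
          (x - a (φ (ψ k)))) atTop (𝓝 ((L.symm.toContinuousLinearEquiv : EuclideanSpace ℝ (Fin 3) →L[ℝ] EuclideanSpace ℝ (Fin 3))
          (x - a₀))) := tendsto_clm_apply hR2χ (tendsto_const_nhds.sub haχ)
      have h2 := hlχ.smul h1
      simpa using h2
    have hm : Tendsto (fun k => m (l (φ (ψ k)) • (R (φ (ψ k))).symm (x - a (φ (ψ k))))) atTop (𝓝 (m (l₀ • L.symm (x - a₀)))) :=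
      (hmc.tendsto _).comp hinner
    have houter : Tendsto (fun k => l (φ (ψ k)) • R (φ (ψ k)) (m (l (φ (ψ k)) • (R (φ (ψ k))).symm (x - a (φ (ψ k))))))
        atTop (𝓝 (l₀ • L (m (l₀ • L.symm (x - a₀))))) := by
      have h1 : Tendsto (fun k => ((R (φ (ψ k))).toContinuousLinearEquiv : EuclideanSpace ℝ (Fin 3) →L[ℝ] EuclideanSpace ℝ (Fin 3))
          (m (l (φ (ψ k)) • (R (φ (ψ k))).symm (x - a (φ (ψ k)))))) atTop
          (𝓝 ((L.toContinuousLinearEquiv : EuclideanSpace ℝ (Fin 3) →L[ℝ] EuclideanSpace ℝ (Fin 3)) (m (l₀ • L.symm (x - a₀))))) :=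
        tendsto_clm_apply hR1χ hm
      have h2 := hlχ.smul h1
      simpa using h2
    have hux : Tendsto (fun k => u (tn (φ (ψ k))) x) atTop (𝓝 (l₀ • L (m (l₀ • L.symm (x - a₀))))) := by
      refine houter.congr fun k => ?_
      rw [hu (φ (ψ k))]
    exact tendsto_nhds_unique ((hptw x).comp hχ.tendsto_atTop) hux
  · -- unbounded translations: the slices would tend to `0` at a point where `u t ≠ 0`
    exfalso
    obtain ⟨ψ, hψ, hnorm⟩ := exists_subseq_norm_tendsto_atTop hb
    obtain ⟨x₀, hx₀⟩ := exists_ne_zero hν hT hmax hLH hdec t ht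
    have hχ : StrictMono (φ ∘ ψ) := hφ.comp hψ
    have hlχ : Tendsto (fun k => l (φ (ψ k))) atTop (𝓝 l₀) := hlconv.comp hχ.tendsto_atTop
    -- the arguments `yₖ = lₖ • Rₖ⁻¹ (x₀ − aₖ)` escape to infinity
    set y : ℕ → EuclideanSpace ℝ (Fin 3) := fun k => l (φ (ψ k)) • (R (φ (ψ k))).symm (x₀ - a (φ (ψ k))) with hy
    have hny : ∀ k, ‖y k‖ = l (φ (ψ k)) * ‖x₀ - a (φ (ψ k))‖ := fun k => by
      simp only [hy, norm_smul, LinearIsometryEquiv.norm_map, Real.norm_eq_abs, abs_of_pos (hl _)]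
    have hdiff : Tendsto (fun k => ‖x₀ - a (φ (ψ k))‖) atTop atTop := by
      have h1 : ∀ k, ‖a (φ (ψ k))‖ - ‖x₀‖ ≤ ‖x₀ - a (φ (ψ k))‖ := fun k => by
        have := norm_sub_norm_le (a (φ (ψ k))) x₀
        rw [norm_sub_rev] at this
        linarith
      refine tendsto_atTop_mono h1 ?_
      exact (tendsto_atTop_add_const_right _ (-‖x₀‖) hnorm).congr fun k => by ring
    have hyn : Tendsto (fun k => ‖y k‖) atTop atTop := by
      have := hlχ.pos_mul_atTop hl₀pos hdiff
      exact this.congr fun k => (hny k).symm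
    have hyco : Tendsto y atTop (cocompact (EuclideanSpace ℝ (Fin 3))) := by
      rw [← Metric.cobounded_eq_cocompact]
      exact tendsto_norm_atTop_iff_cobounded.1 hyn
    have hmy : Tendsto (fun k => m (y k)) atTop (𝓝 0) := hm0.comp hyco
    -- hence `u (tₙ) x₀ → 0` along the subsequence
    have hux : Tendsto (fun k => u (tn (φ (ψ k))) x₀) atTop (𝓝 0) := by
      have h1 : Tendsto (fun k => ‖u (tn (φ (ψ k))) x₀‖) atTop (𝓝 0) := by
        have h2 : ∀ k, ‖u (tn (φ (ψ k))) x₀‖ = l (φ (ψ k)) * ‖m (y k)‖ := fun k => by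
          rw [hu (φ (ψ k))]
          simp only [hy, norm_smul, LinearIsometryEquiv.norm_map, Real.norm_eq_abs, abs_of_pos (hl _)]
        have h3 : Tendsto (fun k => l (φ (ψ k)) * ‖m (y k)‖) atTop (𝓝 (l₀ * 0)) := hlχ.mul (tendsto_zero_iff_norm_tendsto_zero.1 hmy)
        rw [mul_zero] at h3
        exact h3.congr fun k => (h2 k).symm
      exact tendsto_zero_iff_norm_tendsto_zero.2 h1
    have := tendsto_nhds_unique ((hptw x₀).comp hχ.tendsto_atTop) hux
    exact hx₀ this

/-- **The orbit-membership instants of a compact time interval form a closed set.** [folklore] -/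
theorem isClosed_orbitSet {ν T : ℝ} (hν : 0 < ν) (hT : 0 < T)
    {u : ℝ → EuclideanSpace ℝ (Fin 3) → EuclideanSpace ℝ (Fin 3)} {p : ℝ → EuclideanSpace ℝ (Fin 3) → ℝ}
    (hmax : IsMaximalSmoothSolution ν 0 u p T) (hLH : IsLerayHopfOn T ν 0 (u 0) u) (hdec : HasRapidSpatialDecay (u 0))
    {m : EuclideanSpace ℝ (Fin 3) → EuclideanSpace ℝ (Fin 3)} (hmc : Continuous m)
    (hm0 : Tendsto m (cocompact (EuclideanSpace ℝ (Fin 3))) (𝓝 0)) (hZm : 0 < ∫ x, ‖curl m x‖ ^ 2)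
    {s s₁ : ℝ} (hs0 : 0 < s) (hs₁T : s₁ < T) :
    IsClosed {σ ∈ Icc s s₁ | ∃ (a : EuclideanSpace ℝ (Fin 3)) (R : EuclideanSpace ℝ (Fin 3) ≃ₗᵢ[ℝ] EuclideanSpace ℝ (Fin 3)) (l : ℝ),
      0 < l ∧ u σ = fun x => l • R (m (l • R.symm (x - a)))} := by
  refine IsSeqClosed.isClosed fun tn t htn hlim => ?_
  have hI : t ∈ Icc s s₁ := isClosed_Icc.mem_of_tendsto hlim (Eventually.of_forall fun n => (htn n).1)
  have hIoo : ∀ τ ∈ Icc s s₁, τ ∈ Ioo 0 T := fun τ hτ => ⟨hs0.trans_le hτ.1, hτ.2.trans_lt hs₁T⟩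
  exact ⟨hI, mem_orbit_of_tendsto hν hT hmax hLH hdec hmc hm0 hZm (hIoo t hI) hlim fun n => (htn n).2⟩

/-! ## §4 BY NAME: topological orbit selection on a maximiser interval -/

/-- **Finitely many closed sets covering a non-degenerate interval: one contains a non-degenerate sub-interval** (Baire). [folklore] -/
theorem exists_subinterval_of_closed_cover {s s₁ : ℝ} (hss₁ : s < s₁) {k : ℕ} (A : Fin k → Set ℝ)
    (hA : ∀ i, IsClosed (A i)) (hcov : Icc s s₁ ⊆ ⋃ i, A i) :
    ∃ (i : Fin k) (s' s₁' : ℝ), s ≤ s' ∧ s' < s₁' ∧ s₁' ≤ s₁ ∧ Icc s' s₁' ⊆ A i := by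
  -- work in the Baire space `Icc s s₁`
  set B : Fin k → Set (Icc s s₁) := fun i => Subtype.val ⁻¹' A i with hB
  have hBc : ∀ i, IsClosed (B i) := fun i => (hA i).preimage continuous_subtype_val
  have hBU : ⋃ i, B i = univ := by
    ext ⟨σ, hσ⟩
    simp only [mem_iUnion, mem_univ, iff_true, hB, mem_preimage]
    simpa [mem_iUnion] using hcov hσ
  haveI : Nonempty (Icc s s₁) := ⟨⟨s, le_rfl, hss₁.le⟩⟩
  obtain ⟨i, hi⟩ := nonempty_interior_of_iUnion_of_closed hBc hBU
  obtain ⟨σ₀, hσ₀⟩ := hi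
  rw [mem_interior_iff_mem_nhds, Metric.mem_nhds_iff] at hσ₀
  obtain ⟨ε, hε, hball⟩ := hσ₀
  have hσ₀I : (σ₀ : ℝ) ∈ Icc s s₁ := σ₀.2
  -- the sub-interval
  refine ⟨i, max s (σ₀ - ε / 2), min s₁ (σ₀ + ε / 2), le_max_left _ _, ?_, min_le_left _ _, fun σ hσ => ?_⟩
  · have h1 : s < min s₁ ((σ₀ : ℝ) + ε / 2) := lt_min hss₁ (by linarith [hσ₀I.1])
    have h2 : (σ₀ : ℝ) - ε / 2 < min s₁ (σ₀ + ε / 2) := lt_min (by linarith [hσ₀I.2]) (by linarith)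
    exact max_lt h1 h2
  · have hσI : σ ∈ Icc s s₁ := ⟨(le_max_left _ _).trans hσ.1, hσ.2.trans (min_le_left _ _)⟩
    have hdist : dist (⟨σ, hσI⟩ : Icc s s₁) σ₀ < ε := by
      rw [Subtype.dist_eq, Real.dist_eq, abs_lt]
      constructor
      · linarith [(le_max_right _ _).trans hσ.1]
      · linarith [hσ.2.trans (min_le_right _ _)]
    have := hball (Metric.mem_ball.2 hdist)
    simpa [hB] using this

/-- **Topological orbit selection on a maximiser interval** (CLASSIFICATION half of clause (a) of `MaximiserSetRigidity`, profiles
vanishing at infinity). For `c > 0` and `ν > 0`, let `ms : Fin k → _` be profiles with `∫|curl (ms i)|² > 0`, continuous and vanishing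
at infinity, such that every normalised maximiser (route clause verbatim, constant `c`) is `l • R (ms i (l • R⁻¹(· − a)))` for some
`i`, `l > 0`, `R`, `a`. Then along every maximal classical Leray–Hopf rapidly-decaying-datum solution, a maximiser interval
`[s,s₁] ⊂ (0,T)` (all slices normalised maximisers) contains a non-degenerate sub-interval `[s',s₁']` all of whose slices lie in the
orbit of ONE representative `ms i`. [folklore] -/
theorem exists_single_orbit_subinterval {c ν T : ℝ} (hν : 0 < ν) (hT : 0 < T)
    {u : ℝ → EuclideanSpace ℝ (Fin 3) → EuclideanSpace ℝ (Fin 3)} {p : ℝ → EuclideanSpace ℝ (Fin 3) → ℝ}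
    (hmax : IsMaximalSmoothSolution ν 0 u p T) (hLH : IsLerayHopfOn T ν 0 (u 0) u) (hdec : HasRapidSpatialDecay (u 0))
    {k : ℕ} (ms : Fin k → EuclideanSpace ℝ (Fin 3) → EuclideanSpace ℝ (Fin 3))
    (hmsc : ∀ i, Continuous (ms i)) (hms0 : ∀ i, Tendsto (ms i) (cocompact (EuclideanSpace ℝ (Fin 3))) (𝓝 0))
    (hmsZ : ∀ i, 0 < ∫ x, ‖curl (ms i) x‖ ^ 2)
    (hclass : ∀ m : EuclideanSpace ℝ (Fin 3) → EuclideanSpace ℝ (Fin 3), ((ContDiff ℝ (⊤ : ℕ∞) m ∧ VectorCalculus.IsDivFree m ∧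
        (∫⁻ x, ‖iteratedFDeriv ℝ 0 m x‖ₑ ^ 2 < ⊤) ∧ (∫⁻ x, ‖iteratedFDeriv ℝ 1 m x‖ₑ ^ 2 < ⊤) ∧
        (∫⁻ x, ‖iteratedFDeriv ℝ 2 m x‖ₑ ^ 2 < ⊤)) ∧ 0 < (∫ x, ‖curl m x‖ ^ 2) ∧
        (∫ x, ⟪curl m x, fderiv ℝ m x (curl m x)⟫_ℝ) = c * (∫ x, ‖curl m x‖ ^ 2) ^ (3 / 4 : ℝ) *
          (∫ x, frobeniusNormSq (fderiv ℝ (curl m) x)) ^ (3 / 4 : ℝ) ∧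
        (∫ x, frobeniusNormSq (fderiv ℝ (curl m) x)) = 81 * c ^ 4 / (256 * ν ^ 4) * (∫ x, ‖curl m x‖ ^ 2) ^ 3) →
      ∃ (i : Fin k) (a : EuclideanSpace ℝ (Fin 3)) (R : EuclideanSpace ℝ (Fin 3) ≃ₗᵢ[ℝ] EuclideanSpace ℝ (Fin 3)) (l : ℝ),
        0 < l ∧ m = fun x => l • R (ms i (l • R.symm (x - a))))
    {s s₁ : ℝ} (hs0 : 0 < s) (hss₁ : s < s₁) (hs₁T : s₁ < T)
    (hNM : ∀ σ ∈ Icc s s₁, ((ContDiff ℝ (⊤ : ℕ∞) (u σ) ∧ VectorCalculus.IsDivFree (u σ) ∧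
        (∫⁻ x, ‖iteratedFDeriv ℝ 0 (u σ) x‖ₑ ^ 2 < ⊤) ∧ (∫⁻ x, ‖iteratedFDeriv ℝ 1 (u σ) x‖ₑ ^ 2 < ⊤) ∧
        (∫⁻ x, ‖iteratedFDeriv ℝ 2 (u σ) x‖ₑ ^ 2 < ⊤)) ∧ 0 < (∫ x, ‖curl (u σ) x‖ ^ 2) ∧
        (∫ x, ⟪curl (u σ) x, fderiv ℝ (u σ) x (curl (u σ) x)⟫_ℝ) = c * (∫ x, ‖curl (u σ) x‖ ^ 2) ^ (3 / 4 : ℝ) *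
          (∫ x, frobeniusNormSq (fderiv ℝ (curl (u σ)) x)) ^ (3 / 4 : ℝ) ∧
        (∫ x, frobeniusNormSq (fderiv ℝ (curl (u σ)) x)) = 81 * c ^ 4 / (256 * ν ^ 4) * (∫ x, ‖curl (u σ) x‖ ^ 2) ^ 3)) :
    ∃ (i : Fin k) (s' s₁' : ℝ), s ≤ s' ∧ s' < s₁' ∧ s₁' ≤ s₁ ∧ ∀ σ ∈ Icc s' s₁',
      ∃ (a : EuclideanSpace ℝ (Fin 3)) (R : EuclideanSpace ℝ (Fin 3) ≃ₗᵢ[ℝ] EuclideanSpace ℝ (Fin 3)) (l : ℝ),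
        0 < l ∧ u σ = fun x => l • R (ms i (l • R.symm (x - a))) := by
  set A : Fin k → Set ℝ := fun i => {σ ∈ Icc s s₁ | ∃ (a : EuclideanSpace ℝ (Fin 3))
    (R : EuclideanSpace ℝ (Fin 3) ≃ₗᵢ[ℝ] EuclideanSpace ℝ (Fin 3)) (l : ℝ), 0 < l ∧ u σ = fun x => l • R (ms i (l • R.symm (x - a)))}
    with hAdef
  have hA : ∀ i, IsClosed (A i) := fun i => isClosed_orbitSet hν hT hmax hLH hdec (hmsc i) (hms0 i) (hmsZ i) hs0 hs₁T
  have hcov : Icc s s₁ ⊆ ⋃ i, A i := by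
    intro σ hσ
    obtain ⟨i, a, R, l, hl, hform⟩ := hclass (u σ) (hNM σ hσ)
    exact mem_iUnion.2 ⟨i, hσ, a, R, l, hl, hform⟩
  obtain ⟨i, s', s₁', h1, h2, h3, hsub⟩ := exists_subinterval_of_closed_cover hss₁ A hA hcov
  exact ⟨i, s', s₁', h1, h2, h3, fun σ hσ => (hsub hσ).2⟩

end OrbitClosed

end RigidExit

end Summit.NavierStokesRegularity.NavierStokesRegularity.Theorems
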